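import Mathlib.Analysis.SpecialFunctions.Pow.Real
import Mathlib.Analysis.Calculus.Deriv.Pow
import Mathlib.Analysis.Calculus.Deriv.Add
import Mathlib.Analysis.Calculus.Deriv.Mul

/-!
# The Presland–Tallon doping parabola `T_c/T_c,max = 1 − 82.6 (p − 0.16)²` and its inversion

The empirical "universal" relation between the reduced critical temperature
`τ = T_c / T_c,max` of a hole-doped cuprate family and the hole count per planar Cu, `p`,
introduced by Presland–Tallon–Buckley–Liu–Flower and used by Tallon et al. and many later
papers to ASSIGN a doping coordinate from a measured `T_c` [PreslandEtAl1991; TallonEtAl1995];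
printed as Eq. (1) of [LiangBonnHardy2006]: `1 − T_c/T_c,max = 82.6 (p − 0.16)²`.

This file contains NO physics claim about any material: the parabola is a DEFINITION
(`dopingParabola β p₀ p = 1 − β (p − p₀)²`, `preslandTallon = dopingParabola 82.6 0.16`) and the
theorems are the exact algebra every user of the relation performs — the two inverse branches
`p = p₀ ∓ √((1 − τ)/β)` (`dopingParabola_underdopedRoot`, `dopingParabola_overdopedRoot`), the
statement that these are the ONLY solutions (`dopingParabola_eq_iff`), the maximum `τ ≤ 1` with
equality iff `p = p₀`, the symmetry `p₀ + d ↔ p₀ − d`, the `T_c = 0` end points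
`p = p₀ ± 1/√β` (for Presland–Tallon: `0.16 ± 0.110…`, i.e. inside `(0.049, 0.051)` and
`(0.269, 0.271)`), and the derivative `dτ/dp = −2β (p − p₀)` (so that an uncertainty `δτ`
propagates to `δp ≈ δτ / (2β |p − p₀|) = δτ / (2 √(β (1 − τ)))`, which diverges at optimal
doping — the algebraic reason a `T_c`-assigned `p` is loose near `p₀`).

References: M. R. Presland, J. L. Tallon, R. G. Buckley, R. S. Liu, N. E. Flower, Physica C 176
(1991) 95; J. L. Tallon, C. Bernhard, H. Shaked, R. L. Hitterman, J. D. Jorgensen, Phys. Rev. B 51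
(1995) 12911; R. Liang, D. A. Bonn, W. N. Hardy, Phys. Rev. B 73 (2006) 180505(R), Eq. (1).
AI-produced formalisation (H21, cell hubbard-downfold, seat lit-2, 2026-08-27); no facts, no
axioms beyond Mathlib's, no `sorry`.
-/

namespace Literature.MathematicalPhysics.QuantumLattice

open Real

noncomputable section

/-- The doping parabola with curvature `β` and optimal doping `p₀`:
`τ(p) = 1 − β (p − p₀)²` (reduced critical temperature as a function of the planar hole count).
[cite: LiangBonnHardy2006, Eq. (1)] -/
def dopingParabola (β p₀ p : ℝ) : ℝ := 1 - β * (p - p₀) ^ 2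

/-- The Presland–Tallon parabola `T_c/T_c,max = 1 − 82.6 (p − 0.16)²`.
[cite: LiangBonnHardy2006, Eq. (1)] -/
def preslandTallon (p : ℝ) : ℝ := dopingParabola 82.6 0.16 p

/-- The underdoped inverse branch `p = p₀ − √((1 − τ)/β)`. [cite: LiangBonnHardy2006, Eq. (1)] -/
def underdopedRoot (β p₀ τ : ℝ) : ℝ := p₀ - sqrt ((1 - τ) / β)

/-- The overdoped inverse branch `p = p₀ + √((1 − τ)/β)`. [cite: LiangBonnHardy2006, Eq. (1)] -/
def overdopedRoot (β p₀ τ : ℝ) : ℝ := p₀ + sqrt ((1 - τ) / β)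

/-- Unfolding. [cite: LiangBonnHardy2006, Eq. (1)] -/
theorem dopingParabola_def (β p₀ p : ℝ) : dopingParabola β p₀ p = 1 - β * (p - p₀) ^ 2 := rfl

/-- Unfolding of the Presland–Tallon constants. [cite: LiangBonnHardy2006, Eq. (1)] -/
theorem preslandTallon_def (p : ℝ) : preslandTallon p = 1 - 82.6 * (p - 0.16) ^ 2 := rfl

/-! ## Maximum, symmetry, zeros -/

/-- `τ(p) ≤ 1` for `β ≥ 0`. [cite: LiangBonnHardy2006, Eq. (1)] -/
theorem dopingParabola_le_one {β : ℝ} (hβ : 0 ≤ β) (p₀ p : ℝ) : dopingParabola β p₀ p ≤ 1 := by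
  rw [dopingParabola_def]
  nlinarith [sq_nonneg (p - p₀)]

/-- `τ(p₀) = 1` (optimal doping). [cite: LiangBonnHardy2006, Eq. (1)] -/
@[simp] theorem dopingParabola_self (β p₀ : ℝ) : dopingParabola β p₀ p₀ = 1 := by
  simp [dopingParabola_def]

/-- For `β > 0`: `τ(p) = 1 ↔ p = p₀`. [cite: LiangBonnHardy2006, Eq. (1)] -/
theorem dopingParabola_eq_one_iff {β : ℝ} (hβ : 0 < β) (p₀ p : ℝ) :
    dopingParabola β p₀ p = 1 ↔ p = p₀ := by
  rw [dopingParabola_def]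
  constructor
  · intro h
    have h1 : β * (p - p₀) ^ 2 = 0 := by linarith
    rcases mul_eq_zero.mp h1 with h2 | h2
    · exact absurd h2 hβ.ne'
    · have := pow_eq_zero_iff (n := 2) (by norm_num) |>.mp h2
      linarith
  · intro h; subst h; simp

/-- Symmetry about optimal doping: `τ(p₀ + d) = τ(p₀ − d)`. [cite: LiangBonnHardy2006, Eq. (1)] -/
theorem dopingParabola_symm (β p₀ d : ℝ) :
    dopingParabola β p₀ (p₀ + d) = dopingParabola β p₀ (p₀ - d) := by
  simp only [dopingParabola_def]; ring

/-- The `T_c = 0` end points: for `β > 0`, `τ(p) = 0 ↔ p = p₀ − 1/√β ∨ p = p₀ + 1/√β`.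
[cite: LiangBonnHardy2006, Eq. (1)] -/
theorem dopingParabola_eq_zero_iff {β : ℝ} (hβ : 0 < β) (p₀ p : ℝ) :
    dopingParabola β p₀ p = 0 ↔ p = p₀ - 1 / sqrt β ∨ p = p₀ + 1 / sqrt β := by
  rw [dopingParabola_def]
  have hs : 0 < sqrt β := sqrt_pos.mpr hβ
  have hs2 : sqrt β ^ 2 = β := sq_sqrt hβ.le
  have hs' : (1 / sqrt β) ^ 2 = 1 / β := by rw [div_pow, one_pow, hs2]
  constructor
  · intro h
    have h1 : (p - p₀) ^ 2 = (1 / sqrt β) ^ 2 := by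
      rw [hs']; field_simp; linarith
    have h3 : (p - p₀ - 1 / sqrt β) * (p - p₀ + 1 / sqrt β) = 0 := by
      have e : (p - p₀ - 1 / sqrt β) * (p - p₀ + 1 / sqrt β)
          = (p - p₀) ^ 2 - (1 / sqrt β) ^ 2 := by ring
      rw [e, h1, sub_self]
    rcases mul_eq_zero.mp h3 with h4 | h4
    · right; linarith
    · left; linarith
  · rintro (h | h)
    · rw [h, show p₀ - 1 / sqrt β - p₀ = -(1 / sqrt β) by ring, neg_sq, hs']
      field_simp; ring
    · rw [h, show p₀ + 1 / sqrt β - p₀ = 1 / sqrt β by ring, hs']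
      field_simp; ring

/-! ## Inversion: the two branches and uniqueness -/

/-- The underdoped branch inverts the parabola for `τ ≤ 1`, `β > 0`:
`τ(p₀ − √((1 − τ)/β)) = τ`. [cite: LiangBonnHardy2006, Eq. (1)] -/
theorem dopingParabola_underdopedRoot {β τ : ℝ} (hβ : 0 < β) (hτ : τ ≤ 1) (p₀ : ℝ) :
    dopingParabola β p₀ (underdopedRoot β p₀ τ) = τ := by
  rw [dopingParabola_def, underdopedRoot]
  have h : 0 ≤ (1 - τ) / β := div_nonneg (by linarith) hβ.le
  have : (p₀ - sqrt ((1 - τ) / β) - p₀) ^ 2 = (1 - τ) / β := by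
    rw [show p₀ - sqrt ((1 - τ) / β) - p₀ = -sqrt ((1 - τ) / β) by ring, neg_sq, sq_sqrt h]
  rw [this]; field_simp; ring

/-- The overdoped branch inverts the parabola for `τ ≤ 1`, `β > 0`:
`τ(p₀ + √((1 − τ)/β)) = τ`. [cite: LiangBonnHardy2006, Eq. (1)] -/
theorem dopingParabola_overdopedRoot {β τ : ℝ} (hβ : 0 < β) (hτ : τ ≤ 1) (p₀ : ℝ) :
    dopingParabola β p₀ (overdopedRoot β p₀ τ) = τ := by
  rw [dopingParabola_def, overdopedRoot]
  have h : 0 ≤ (1 - τ) / β := div_nonneg (by linarith) hβ.le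
  have : (p₀ + sqrt ((1 - τ) / β) - p₀) ^ 2 = (1 - τ) / β := by
    rw [show p₀ + sqrt ((1 - τ) / β) - p₀ = sqrt ((1 - τ) / β) by ring, sq_sqrt h]
  rw [this]; field_simp; ring

/-- The branches sit on the correct sides: `underdopedRoot ≤ p₀ ≤ overdopedRoot`.
[cite: LiangBonnHardy2006, Eq. (1)] -/
theorem underdopedRoot_le_self_le_overdopedRoot (β p₀ τ : ℝ) :
    underdopedRoot β p₀ τ ≤ p₀ ∧ p₀ ≤ overdopedRoot β p₀ τ := by
  have := sqrt_nonneg ((1 - τ) / β)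
  exact ⟨by rw [underdopedRoot]; linarith, by rw [overdopedRoot]; linarith⟩

/-- The two branches are mirror images: `under + over = 2 p₀`. [cite: LiangBonnHardy2006, Eq. (1)] -/
theorem underdopedRoot_add_overdopedRoot (β p₀ τ : ℝ) :
    underdopedRoot β p₀ τ + overdopedRoot β p₀ τ = 2 * p₀ := by
  rw [underdopedRoot, overdopedRoot]; ring

/-- **Uniqueness of the inversion**: for `β > 0` and `τ ≤ 1`, `τ(p) = τ` iff `p` is one of the two
branches. [cite: LiangBonnHardy2006, Eq. (1)] -/
theorem dopingParabola_eq_iff {β τ : ℝ} (hβ : 0 < β) (hτ : τ ≤ 1) (p₀ p : ℝ) :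
    dopingParabola β p₀ p = τ ↔ p = underdopedRoot β p₀ τ ∨ p = overdopedRoot β p₀ τ := by
  constructor
  · intro h
    rw [dopingParabola_def] at h
    have h0 : 0 ≤ (1 - τ) / β := div_nonneg (by linarith) hβ.le
    have hs2 : sqrt ((1 - τ) / β) ^ 2 = (1 - τ) / β := sq_sqrt h0
    have h1 : (p - p₀) ^ 2 = sqrt ((1 - τ) / β) ^ 2 := by
      rw [hs2]; field_simp; linarith
    have h3 : (p - p₀ - sqrt ((1 - τ) / β)) * (p - p₀ + sqrt ((1 - τ) / β)) = 0 := by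
      have e : (p - p₀ - sqrt ((1 - τ) / β)) * (p - p₀ + sqrt ((1 - τ) / β))
          = (p - p₀) ^ 2 - sqrt ((1 - τ) / β) ^ 2 := by ring
      rw [e, h1, sub_self]
    rcases mul_eq_zero.mp h3 with h4 | h4
    · right; rw [overdopedRoot]; linarith
    · left; rw [underdopedRoot]; linarith
  · rintro (h | h)
    · rw [h]; exact dopingParabola_underdopedRoot hβ hτ p₀
    · rw [h]; exact dopingParabola_overdopedRoot hβ hτ p₀

/-! ## Monotonicity on each side of optimal doping -/

/-- Underdoped side: `τ` is strictly increasing in `p` on `(−∞, p₀]` (for `β > 0`).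
[cite: LiangBonnHardy2006, Eq. (1)] -/
theorem dopingParabola_strictMonoOn {β : ℝ} (hβ : 0 < β) (p₀ : ℝ) :
    StrictMonoOn (dopingParabola β p₀) (Set.Iic p₀) := by
  intro a ha b hb hab
  simp only [Set.mem_Iic] at ha hb
  rw [dopingParabola_def, dopingParabola_def]
  have : (b - p₀) ^ 2 < (a - p₀) ^ 2 := by nlinarith
  nlinarith

/-- Overdoped side: `τ` is strictly decreasing in `p` on `[p₀, ∞)` (for `β > 0`).
[cite: LiangBonnHardy2006, Eq. (1)] -/
theorem dopingParabola_strictAntiOn {β : ℝ} (hβ : 0 < β) (p₀ : ℝ) :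
    StrictAntiOn (dopingParabola β p₀) (Set.Ici p₀) := by
  intro a ha b hb hab
  simp only [Set.mem_Ici] at ha hb
  rw [dopingParabola_def, dopingParabola_def]
  have : (a - p₀) ^ 2 < (b - p₀) ^ 2 := by nlinarith
  nlinarith

/-- `τ(p) > 0` exactly on the open window `|p − p₀| < 1/√β` (for `β > 0`).
[cite: LiangBonnHardy2006, Eq. (1)] -/
theorem dopingParabola_pos_iff {β : ℝ} (hβ : 0 < β) (p₀ p : ℝ) :
    0 < dopingParabola β p₀ p ↔ |p - p₀| < 1 / sqrt β := by
  rw [dopingParabola_def]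
  have hs : 0 < sqrt β := sqrt_pos.mpr hβ
  have hs2 : sqrt β ^ 2 = β := sq_sqrt hβ.le
  have hab : |p - p₀| ^ 2 = (p - p₀) ^ 2 := sq_abs _
  have h0 : 0 ≤ |p - p₀| * sqrt β := by positivity
  rw [lt_div_iff₀ hs]
  constructor
  · intro h
    by_contra hc
    rw [not_lt] at hc
    have h1 : (1 : ℝ) * 1 ≤ (|p - p₀| * sqrt β) * (|p - p₀| * sqrt β) :=
      mul_le_mul hc hc zero_le_one h0
    have h2 : (|p - p₀| * sqrt β) * (|p - p₀| * sqrt β) = (p - p₀) ^ 2 * β := by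
      calc (|p - p₀| * sqrt β) * (|p - p₀| * sqrt β) = |p - p₀| ^ 2 * sqrt β ^ 2 := by ring
        _ = (p - p₀) ^ 2 * β := by rw [hab, hs2]
    rw [h2] at h1
    linarith
  · intro h
    have h1 : (|p - p₀| * sqrt β) * (|p - p₀| * sqrt β) < 1 * 1 := mul_lt_mul'' h h h0 h0
    have h2 : (|p - p₀| * sqrt β) * (|p - p₀| * sqrt β) = (p - p₀) ^ 2 * β := by
      calc (|p - p₀| * sqrt β) * (|p - p₀| * sqrt β) = |p - p₀| ^ 2 * sqrt β ^ 2 := by ring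
        _ = (p - p₀) ^ 2 * β := by rw [hab, hs2]
    rw [h2] at h1
    linarith

/-! ## Derivative (error propagation `δp = δτ / (2β|p − p₀|)`) -/

/-- `dτ/dp = −2β (p − p₀)`. [cite: LiangBonnHardy2006, Eq. (1)] -/
theorem hasDerivAt_dopingParabola (β p₀ p : ℝ) :
    HasDerivAt (dopingParabola β p₀) (-(2 * β * (p - p₀))) p := by
  have h1 : HasDerivAt (fun q : ℝ => q - p₀) 1 p := (hasDerivAt_id p).sub_const p₀
  have h2 : HasDerivAt (fun q : ℝ => (q - p₀) * (q - p₀)) (1 * (p - p₀) + (p - p₀) * 1) p :=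
    h1.mul h1
  have h3 : HasDerivAt (fun q : ℝ => 1 - β * ((q - p₀) * (q - p₀)))
      (0 - β * (1 * (p - p₀) + (p - p₀) * 1)) p :=
    (hasDerivAt_const p (1 : ℝ)).sub (h2.const_mul β)
  have e : (fun q : ℝ => 1 - β * ((q - p₀) * (q - p₀))) = dopingParabola β p₀ := by
    funext q; rw [dopingParabola_def]; ring
  rw [e] at h3
  convert h3 using 1
  ring

/-- The slope vanishes only at optimal doping (for `β ≠ 0`): the inverse map `τ ↦ p` has
unbounded sensitivity there. [cite: LiangBonnHardy2006, Eq. (1)] -/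
theorem deriv_dopingParabola_eq_zero_iff {β : ℝ} (hβ : β ≠ 0) (p₀ p : ℝ) :
    deriv (dopingParabola β p₀) p = 0 ↔ p = p₀ := by
  rw [(hasDerivAt_dopingParabola β p₀ p).deriv]
  constructor
  · intro h
    have : 2 * β * (p - p₀) = 0 := by linarith
    rcases mul_eq_zero.mp this with h1 | h1
    · exact absurd (by simpa using h1) hβ
    · linarith
  · intro h; subst h; ring

/-- On a branch, the slope in terms of `τ`: at `p = overdopedRoot β p₀ τ` (`β > 0`) one has
`dτ/dp = −2 √(β (1 − τ))`; at the underdoped root `+2 √(β (1 − τ))` (both sides are `0` when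
`τ > 1`, by the `sqrt` convention). [cite: LiangBonnHardy2006, Eq. (1)] -/
theorem deriv_dopingParabola_roots {β : ℝ} (hβ : 0 < β) (τ p₀ : ℝ) :
    deriv (dopingParabola β p₀) (overdopedRoot β p₀ τ) = -(2 * sqrt (β * (1 - τ))) ∧
      deriv (dopingParabola β p₀) (underdopedRoot β p₀ τ) = 2 * sqrt (β * (1 - τ)) := by
  have key : β * sqrt ((1 - τ) / β) = sqrt (β * (1 - τ)) := by
    have e : β * (1 - τ) = β ^ 2 * ((1 - τ) / β) := by field_simp
    rw [e, Real.sqrt_mul (sq_nonneg β), Real.sqrt_sq hβ.le]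
  constructor
  · rw [(hasDerivAt_dopingParabola β p₀ _).deriv, overdopedRoot]
    rw [show p₀ + sqrt ((1 - τ) / β) - p₀ = sqrt ((1 - τ) / β) by ring, ← key]; ring
  · rw [(hasDerivAt_dopingParabola β p₀ _).deriv, underdopedRoot]
    rw [show p₀ - sqrt ((1 - τ) / β) - p₀ = -sqrt ((1 - τ) / β) by ring, mul_neg, neg_neg, ← key]
    ring

/-! ## The Presland–Tallon constants: numeric end points -/

/-- `82.6 > 0`. [cite: LiangBonnHardy2006, Eq. (1)] -/
theorem preslandTallon_curvature_pos : (0 : ℝ) < 82.6 := by norm_num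

/-- The `T_c = 0` end points of the Presland–Tallon parabola, `0.16 ∓ 1/√82.6`, lie in
`(0.049, 0.051)` and `(0.269, 0.271)` respectively (`1/√82.6 = 0.1100…`).
[cite: LiangBonnHardy2006, Eq. (1)] -/
theorem preslandTallon_endpoints_bounds :
    (0.049 : ℝ) < 0.16 - 1 / sqrt 82.6 ∧ 0.16 - 1 / sqrt 82.6 < 0.051 ∧
      (0.269 : ℝ) < 0.16 + 1 / sqrt 82.6 ∧ 0.16 + 1 / sqrt 82.6 < 0.271 := by
  have hs : 0 < sqrt (82.6 : ℝ) := sqrt_pos.mpr (by norm_num)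
  have hs2 : sqrt (82.6 : ℝ) ^ 2 = 82.6 := sq_sqrt (by norm_num)
  -- 1/√82.6 ∈ (0.109, 0.111): from 82.6 · 0.109² < 1 < 82.6 · 0.111²
  have hlo : (0.109 : ℝ) < 1 / sqrt 82.6 := by
    rw [lt_div_iff₀ hs]
    nlinarith
  have hhi : 1 / sqrt 82.6 < (0.111 : ℝ) := by
    rw [div_lt_iff₀ hs]
    nlinarith
  refine ⟨by linarith, by linarith, by linarith, by linarith⟩

/-- `preslandTallon p = 0` iff `p` is one of the two end points `0.16 ∓ 1/√82.6`.
[cite: LiangBonnHardy2006, Eq. (1)] -/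
theorem preslandTallon_eq_zero_iff (p : ℝ) :
    preslandTallon p = 0 ↔ p = 0.16 - 1 / sqrt 82.6 ∨ p = 0.16 + 1 / sqrt 82.6 :=
  dopingParabola_eq_zero_iff preslandTallon_curvature_pos 0.16 p

/-- The Presland–Tallon inversion used in practice: for `τ = T_c/T_c,max ≤ 1`,
`preslandTallon p = τ ↔ p = 0.16 − √((1 − τ)/82.6) ∨ p = 0.16 + √((1 − τ)/82.6)`.
[cite: LiangBonnHardy2006, Eq. (1)] -/
theorem preslandTallon_eq_iff {τ : ℝ} (hτ : τ ≤ 1) (p : ℝ) :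
    preslandTallon p = τ ↔
      p = 0.16 - sqrt ((1 - τ) / 82.6) ∨ p = 0.16 + sqrt ((1 - τ) / 82.6) :=
  dopingParabola_eq_iff preslandTallon_curvature_pos hτ 0.16 p

end

end Literature.MathematicalPhysics.QuantumLattice
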